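import Literature.Probability.RandomPlanarGeometry.SAWPulledLargeForceExpansionZdWordTypesSix
import Literature.Probability.RandomPlanarGeometry.SAWCountZdBadWordTypes
import HarnessLib

/-!
# The census law (L1) at the level of canonical words: the class-D44 PLACEMENT (two overlapping squares)

Topic `Literature/Probability/RandomPlanarGeometry` (continues `SAWCountZdBadWordTypes.lean` — `G_n(u) = u!·#{canonical bad words}` and the law (L1)
from ONE count of canonical words `2^{n−3}(n³ − 9n² + 29n − 40)` — and uses a-p3 g18's `SAWPulledLargeForceExpansionZdWordTypesSix.lean`:
`growthOK_iff_canon_eq` (canonical = restricted growth)).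

PRINTED CONTEXT (locators only; nothing quoted). Madras–Slade (1993) Definition 1.2.4, §1.1 eq. (1.1.8) p. 5. NOT IN PRINT: everything below.

THIS FILE (lane «pcv-sawmu», a-p1 g20) is the TEMPLATE for the five class counts of the lane's DESIGN-ZD-CENSUS-LAW-L1 (§2b: the canonical bad
words of length `n` with `n−3` axes split by loop signature into classes with `2^{n−3}·[4(n−4)², (n−5)²(n−3), n−4, n−5, 4(n−5)]` members), worked
out for the simplest class `(4,4)` = two overlapping squares `x y x̄ ȳ x`:
* tool notions `d44ax`, `d44sg`, `d44Word l k hk σ` (the placement word: axes `0,…,k−1, k,k+1,k,k+1,k, k+2,…`, signs `σ` at first use, flipped at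
  the second use inside the window), `d44WordT` (total version);
* `canon_d44Word` (restricted growth ⇒ canonical), `noRev_d44Word`, `wordPos_d44Word_rep` (repeats at `(k,k+4)` and `(k+1,k+5)`),
  `numAxes_d44Word` (`= n − 3`), `d44Word_inj` (the word determines `k` and `σ` on the axes `< n−3`);
* ★★ `mul_pow_le_card_doubleSquare_canonical` — at least `(n−4)·2^{n−3}` canonical reversal-free words of length `n` with `n−3` axes have the
  two overlapping squares (the lane's enumeration: exactly that many, class `(4,4)`; the upper bound and the other four classes are the heirs').
[cite: MadrasSlade1993, Definition 1.2.4; §1.1 eq. (1.1.8) p. 5]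

Provenance: lane «pcv-sawmu», a-p1 g20 (2026-08-27).
-/

noncomputable section

open Finset
open scoped BigOperators
open Literature.Probability.LatticeModels
open Literature.Probability.RandomPlanarGeometry.SAW
open Literature.Probability.Percolation

namespace Literature.Probability.RandomPlanarGeometry.SAW.Zd

namespace WordTypes

/-- axis of position `p` for the D44 word with window at `k`: `0,1,…,k−1, k,k+1,k,k+1,k, k+2,k+3,…`. [cite: MadrasSlade1993, Definition 1.2.4; lane tool notion] -/
def d44ax (k p : ℕ) : ℕ := if p < k then p else if p ≤ k + 4 then (if (p - k) % 2 = 0 then k else k + 1) else p - 3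

/-- sign of position `p`: the sign of an axis is `σ` at its first use, flipped at the second use inside the window. [cite: MadrasSlade1993, Definition 1.2.4; lane tool notion] -/
def d44sg (k : ℕ) (σ : ℕ → Bool) (p : ℕ) : Bool :=
  if p < k then σ p else if p = k + 2 then !σ k else if p = k + 3 then !σ (k + 1) else if p ≤ k + 4 then σ (d44ax k p) else σ (p - 3)

/-- `d44ax_lt` (class-D44 placement plumbing). [cite: MadrasSlade1993, Definition 1.2.4; lane plumbing] -/
theorem d44ax_lt {l k p : ℕ} (hk : k + 5 ≤ l + 3) (hp : p < l + 3) : d44ax k p < l + 3 := by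
  unfold d44ax; split_ifs <;> omega

/-- THE D44 PLACEMENT WORD (length `l + 3`, window at `k`, `k + 5 ≤ l + 3`). [cite: MadrasSlade1993, Definition 1.2.4; lane tool notion] -/
def d44Word (l k : ℕ) (hk : k + 5 ≤ l + 3) (σ : ℕ → Bool) : Word (l + 3) (l + 3) :=
  fun p => (⟨d44ax k p.val, d44ax_lt hk p.2⟩, d44sg k σ p.val)

/-- `d44Word_axis` (class-D44 placement plumbing). [cite: MadrasSlade1993, Definition 1.2.4; lane plumbing] -/
theorem d44Word_axis (l k : ℕ) (hk : k + 5 ≤ l + 3) (σ : ℕ → Bool) (p : Fin (l + 3)) :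
    ((d44Word l k hk σ p).1 : ℕ) = d44ax k p.val := rfl

/-- Restricted growth ⇒ canonical. [cite: MadrasSlade1993, Definition 1.2.4; lane tool notion] -/
theorem canon_d44Word (l k : ℕ) (hk : k + 5 ≤ l + 3) (σ : ℕ → Bool) : canon (d44Word l k hk σ) = d44Word l k hk σ := by
  rw [← growthOK_iff_canon_eq]
  intro p
  rw [d44Word_axis]
  -- either the axis is `0`, or some earlier position carries `axis − 1` (or more)
  by_cases h0 : d44ax k p.val = 0
  · rw [h0]; exact Nat.zero_le _
  · -- the witness position
    have hq : ∃ q : ℕ, q < p.val ∧ d44ax k p.val ≤ d44ax k q + 1 := by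
      unfold d44ax at h0 ⊢
      by_cases h1 : p.val < k
      · rw [if_pos h1] at h0
        exact ⟨p.val - 1, by omega, by rw [if_pos h1, if_pos (by omega)]; omega⟩
      · by_cases h2 : p.val ≤ k + 4
        · rw [if_neg h1, if_pos h2] at h0 ⊢
          by_cases h3 : (p.val - k) % 2 = 0
          · rw [if_pos h3] at h0 ⊢
            -- axis k ≥ 1: position k − 1 carries k − 1 (if p = k) or position k+1 carries k+1
            by_cases hpk : p.val = k
            · exact ⟨k - 1, by omega, by rw [if_pos (by omega)]; omega⟩
            · exact ⟨k + 1, by omega, by rw [if_neg (by omega), if_pos (by omega), if_neg (by omega)]; omega⟩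
          · rw [if_neg h3]
            exact ⟨k, by omega, by rw [if_neg (by omega), if_pos (by omega), if_pos (by omega)]⟩
        · rw [if_neg h1, if_neg h2] at h0 ⊢
          by_cases h4 : p.val = k + 5
          · exact ⟨k + 1, by omega, by rw [if_neg (by omega), if_pos (by omega), if_neg (by omega)]; omega⟩
          · exact ⟨p.val - 1, by omega, by rw [if_neg (by omega), if_neg (by omega)]; omega⟩
    obtain ⟨q, hqp, hle⟩ := hq
    refine hle.trans ?_
    have hmem : (⟨q, by omega⟩ : Fin (l + 3)) ∈ Finset.univ.filter (fun q' : Fin (l + 3) => q' < p) :=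
      Finset.mem_filter.2 ⟨Finset.mem_univ _, by change q < p.val; exact hqp⟩
    exact Finset.le_sup (f := fun q' : Fin (l + 3) => ((d44Word l k hk σ q').1 : ℕ) + 1) hmem

/-- No immediate reversal: consecutive positions carry different axes. [cite: MadrasSlade1993, Definition 1.2.4; lane tool notion] -/
theorem noRev_d44Word (l k : ℕ) (hk : k + 5 ≤ l + 3) (σ : ℕ → Bool) :
    ∀ p : Fin (l + 3), ∀ hp : p.val + 1 < l + 3,
      d44Word l k hk σ ⟨p.val + 1, hp⟩ ≠ ((d44Word l k hk σ p).1, !(d44Word l k hk σ p).2) := by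
  intro p hp h
  have hax : d44ax k (p.val + 1) = d44ax k p.val := by
    have := congrArg (fun x : Idx (l + 3) => (x.1 : ℕ)) h
    simpa [d44Word] using this
  unfold d44ax at hax
  split_ifs at hax <;> omega

/-- `d44ax_window` (class-D44 placement plumbing). [cite: MadrasSlade1993, Definition 1.2.4; lane plumbing] -/
theorem d44ax_window (k : ℕ) : d44ax k k = k ∧ d44ax k (k + 1) = k + 1 ∧ d44ax k (k + 2) = k ∧ d44ax k (k + 3) = k + 1 ∧
    d44ax k (k + 4) = k := by
  unfold d44ax
  refine ⟨?_, ?_, ?_, ?_, ?_⟩ <;> simp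

/-- `d44sg_window` (class-D44 placement plumbing). [cite: MadrasSlade1993, Definition 1.2.4; lane plumbing] -/
theorem d44sg_window (k : ℕ) (σ : ℕ → Bool) : d44sg k σ k = σ k ∧ d44sg k σ (k + 1) = σ (k + 1) ∧ d44sg k σ (k + 2) = !σ k ∧
    d44sg k σ (k + 3) = !σ (k + 1) ∧ d44sg k σ (k + 4) = σ k := by
  obtain ⟨a0, a1, a2, a3, a4⟩ := d44ax_window k
  unfold d44sg
  refine ⟨?_, ?_, ?_, ?_, ?_⟩
  · simp [a0]
  · simp [a1]
  · simp
  · simp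
  · simp [a4]

/-- The two overlapping squares: repeats at `(k, k+4)` and `(k+1, k+5)`. [cite: MadrasSlade1993, Definition 1.2.4; lane tool notion] -/
theorem wordPos_d44Word_rep (l k : ℕ) (hk : k + 5 ≤ l + 3) (σ : ℕ → Bool) (j : ℕ) (hj : j = k ∨ j = k + 1) :
    wordPos (d44Word l k hk σ) j = wordPos (d44Word l k hk σ) (j + 4) := by
  set w := d44Word l k hk σ with hw
  have s0 : wordPos w (j + 1) = wordPos w j + stepVec (w ⟨j, by omega⟩) := wordPos_succ w (by omega)
  have s1 : wordPos w (j + 2) = wordPos w (j + 1) + stepVec (w ⟨j + 1, by omega⟩) := wordPos_succ w (by omega)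
  have s2 : wordPos w (j + 3) = wordPos w (j + 2) + stepVec (w ⟨j + 2, by omega⟩) := wordPos_succ w (by omega)
  have s3 : wordPos w (j + 4) = wordPos w (j + 3) + stepVec (w ⟨j + 3, by omega⟩) := wordPos_succ w (by omega)
  obtain ⟨a0, a1, a2, a3, a4⟩ := d44ax_window k
  obtain ⟨g0, g1, g2, g3, g4⟩ := d44sg_window k σ
  have e1 : stepVec (w ⟨j, by omega⟩) + stepVec (w ⟨j + 2, by omega⟩) = 0 := by
    rw [stepVec_add_eq_zero_iff_eq_rev, hw]
    unfold d44Word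
    rcases hj with rfl | rfl
    · ext <;> simp [a0, a2, g0, g2]
    · ext <;> simp [a1, a3, g1, g3, show k + 1 + 2 = k + 3 by omega]
  have e2 : stepVec (w ⟨j + 1, by omega⟩) + stepVec (w ⟨j + 3, by omega⟩) = 0 := by
    rw [stepVec_add_eq_zero_iff_eq_rev, hw]
    unfold d44Word
    rcases hj with rfl | rfl
    · ext <;> simp [a1, a3, g1, g3]
    · ext <;> simp [a2, a4, g2, g4, show k + 1 + 1 = k + 2 by omega, show k + 1 + 3 = k + 4 by omega]
  have : wordPos w (j + 4) = wordPos w j + (stepVec (w ⟨j, by omega⟩) + stepVec (w ⟨j + 2, by omega⟩)) +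
      (stepVec (w ⟨j + 1, by omega⟩) + stepVec (w ⟨j + 3, by omega⟩)) := by
    rw [s3, s2, s1, s0]; abel
  rw [this, e1, e2, add_zero, add_zero]


/-- `d44ax_lt_l` (class-D44 placement plumbing). [cite: MadrasSlade1993, Definition 1.2.4; lane plumbing] -/
theorem d44ax_lt_l {l k p : ℕ} (hk : k + 5 ≤ l + 3) (hp : p < l + 3) : d44ax k p < l := by
  unfold d44ax; split_ifs <;> omega

/-- The D44 word uses exactly the axes `0, …, l−1`: `numAxes = l` (= `n − 3`). [cite: MadrasSlade1993, Definition 1.2.4; lane tool notion] -/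
theorem numAxes_d44Word (l k : ℕ) (hk : k + 5 ≤ l + 3) (σ : ℕ → Bool) : numAxes (d44Word l k hk σ) = l := by
  classical
  rw [numAxes_eq_card_image]
  have himg : (Finset.univ.image fun p : Fin (l + 3) => (d44Word l k hk σ p).1) =
      (Finset.univ : Finset (Fin l)).map (Fin.castLEEmb (by omega : l ≤ l + 3)) := by
    ext a
    simp only [Finset.mem_image, Finset.mem_univ, true_and, Finset.mem_map, Fin.castLEEmb_apply]
    constructor
    · rintro ⟨p, hp⟩
      have ha : a.val < l := by rw [← hp]; exact d44ax_lt_l hk p.2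
      exact ⟨⟨a.val, ha⟩, Fin.ext rfl⟩
    · rintro ⟨b, rfl⟩
      by_cases h1 : b.val < k
      · refine ⟨⟨b.val, by omega⟩, Fin.ext ?_⟩
        have : d44ax k b.val = b.val := by unfold d44ax; rw [if_pos h1]
        simpa [d44Word] using this
      · by_cases h2 : b.val ≤ k + 1
        · refine ⟨⟨b.val, by omega⟩, Fin.ext ?_⟩
          have : d44ax k b.val = b.val := by unfold d44ax; split_ifs <;> omega
          simpa [d44Word] using this
        · refine ⟨⟨b.val + 3, by omega⟩, Fin.ext ?_⟩
          have : d44ax k (b.val + 3) = b.val := by unfold d44ax; split_ifs <;> omega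
          simpa [d44Word] using this
  rw [himg, Finset.card_map, Finset.card_univ, Fintype.card_fin]

/-- The window position is recovered from the word: the positions whose axis is smaller than the position are exactly `p ≥ k + 2`. [cite: MadrasSlade1993, Definition 1.2.4; lane tool notion] -/
theorem d44ax_lt_self_iff {k p : ℕ} : d44ax k p < p ↔ k + 2 ≤ p := by
  unfold d44ax; split_ifs <;> omega

/-- Injectivity of the placement: the word determines `k` and the signs of the axes `< l`. [cite: MadrasSlade1993, Definition 1.2.4; lane tool notion] -/
theorem d44Word_inj {l k k' : ℕ} (hk : k + 5 ≤ l + 3) (hk' : k' + 5 ≤ l + 3) {σ σ' : ℕ → Bool}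
    (h : d44Word l k hk σ = d44Word l k' hk' σ') : k = k' ∧ ∀ a, a < l → σ a = σ' a := by
  have hax : ∀ p : ℕ, p < l + 3 → d44ax k p = d44ax k' p := fun p hp => by
    have := congrArg (fun w : Word (l + 3) (l + 3) => ((w ⟨p, hp⟩).1 : ℕ)) h
    simpa [d44Word] using this
  have hkk : k = k' := by
    have h1 := (d44ax_lt_self_iff (k := k) (p := k + 2)).2 le_rfl
    have h2 := (d44ax_lt_self_iff (k := k') (p := k' + 2)).2 le_rfl
    rw [hax (k + 2) (by omega)] at h1
    rw [← hax (k' + 2) (by omega)] at h2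
    have := (d44ax_lt_self_iff (k := k')).1 h1
    have := (d44ax_lt_self_iff (k := k)).1 h2
    omega
  subst hkk
  refine ⟨rfl, fun a ha => ?_⟩
  have hsg : ∀ p : ℕ, p < l + 3 → d44sg k σ p = d44sg k σ' p := fun p hp => by
    have := congrArg (fun w : Word (l + 3) (l + 3) => (w ⟨p, hp⟩).2) h
    simpa [d44Word] using this
  by_cases h1 : a < k
  · have e := hsg a (by omega); unfold d44sg at e; rwa [if_pos h1, if_pos h1] at e
  · by_cases h2 : a ≤ k + 1
    · have e := hsg a (by omega)
      have hx : d44ax k a = a := by unfold d44ax; split_ifs <;> omega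
      unfold d44sg at e
      have hB : a ≠ k + 2 := by omega
      have hC : a ≠ k + 3 := by omega
      have hD : a ≤ k + 4 := by omega
      simpa [h1, hB, hC, hD, hx] using e
    · have e := hsg (a + 3) (by omega)
      unfold d44sg at e
      have hA : ¬ a + 3 < k := by omega
      have hB : a + 3 ≠ k + 2 := by omega
      have hC : a + 3 ≠ k + 3 := by omega
      have hD : ¬ a + 3 ≤ k + 4 := by omega
      have hE : a ≠ k := by omega
      have hF : a ≠ k + 1 := by omega
      simpa [hA, hB, hC, hD, hE, hF] using e


/-- The placement as a total function of `(k, σ') ∈ ℕ × (Fin l → Bool)` (junk outside `k + 5 ≤ l + 3`). [cite: MadrasSlade1993, Definition 1.2.4; lane tool notion] -/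
def d44WordT (l : ℕ) (x : ℕ × (Fin l → Bool)) : Word (l + 3) (l + 3) :=
  if h : x.1 + 5 ≤ l + 3 then d44Word l x.1 h (fun a => if ha : a < l then x.2 ⟨a, ha⟩ else false) else fun _ => (0, false)

open Classical in
/-- ★★ THE CLASS-D44 LOWER BOUND of the census law (L1): among the canonical reversal-free words of length `n = l + 3` with `l` axes there are
at least `(n−4)·2^{n−3}` with two overlapping squares `x y x̄ ȳ x` (repeats at `(k,k+4)` and `(k+1,k+5)`): the placements `(k, σ)`.
(The lane's enumeration says this is the exact count of the loop-signature class `(4,4)`; lane DESIGN-ZD-CENSUS-LAW-L1 §2b.)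
[cite: MadrasSlade1993, Definition 1.2.4; §1.1 eq. (1.1.8) p. 5; lane theorem] -/
theorem mul_pow_le_card_doubleSquare_canonical (l : ℕ) :
    (l - 1) * 2 ^ l ≤ (Finset.univ.filter fun τ : Word (l + 3) (l + 3) => canon τ = τ ∧ numAxes τ = l ∧
        (∀ p : Fin (l + 3), ∀ hp : p.val + 1 < l + 3, τ ⟨p.val + 1, hp⟩ ≠ ((τ p).1, !(τ p).2)) ∧
        ∃ k : ℕ, k + 5 ≤ l + 3 ∧ wordPos τ k = wordPos τ (k + 4) ∧ wordPos τ (k + 1) = wordPos τ (k + 5)).card := by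
  set P : Finset (ℕ × (Fin l → Bool)) := (Finset.range (l - 1)) ×ˢ Finset.univ with hP
  have hPcard : P.card = (l - 1) * 2 ^ l := by
    rw [hP, Finset.card_product, Finset.card_range, Finset.card_univ, Fintype.card_fun, Fintype.card_bool, Fintype.card_fin]
  rw [← hPcard]
  refine Finset.card_le_card_of_injOn (d44WordT l) (fun x hx => ?_) (fun x hx y hy hxy => ?_)
  · -- the placement lands in the class
    obtain ⟨hk, -⟩ := Finset.mem_product.1 hx
    have hk5 : x.1 + 5 ≤ l + 3 := by have := Finset.mem_range.1 hk; omega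
    simp only [Finset.coe_filter, Finset.mem_univ, true_and, Set.mem_setOf_eq, d44WordT, dif_pos hk5]
    exact ⟨canon_d44Word l x.1 hk5 _, numAxes_d44Word l x.1 hk5 _, noRev_d44Word l x.1 hk5 _, x.1, hk5,
      wordPos_d44Word_rep l x.1 hk5 _ x.1 (Or.inl rfl), wordPos_d44Word_rep l x.1 hk5 _ (x.1 + 1) (Or.inr rfl)⟩
  · -- injectivity
    obtain ⟨hkx, -⟩ := Finset.mem_product.1 hx
    obtain ⟨hky, -⟩ := Finset.mem_product.1 hy
    have hx5 : x.1 + 5 ≤ l + 3 := by have := Finset.mem_range.1 hkx; omega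
    have hy5 : y.1 + 5 ≤ l + 3 := by have := Finset.mem_range.1 hky; omega
    simp only [d44WordT, dif_pos hx5, dif_pos hy5] at hxy
    obtain ⟨hk, hσ⟩ := d44Word_inj hx5 hy5 hxy
    refine Prod.ext hk (funext fun a => ?_)
    have := hσ a.val a.2
    simpa using this

/-! ### Class `(4,6)`: a square inside a hexagon `b x y x̄ ȳ b̄` (appended, ed.2) -/

/-- Axis of position `p` for the D46 word with window at `k`: `0,…,k−1, k,k+1,k+2,k+1,k+2,k, k+3,…` (tool notion).
[cite: MadrasSlade1993, Definition 1.2.4; lane tool notion] -/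
def d46ax (k p : ℕ) : ℕ :=
  if p < k then p else if p ≤ k + 5 then (if p = k ∨ p = k + 5 then k else if p = k + 1 ∨ p = k + 3 then k + 1 else k + 2) else p - 3

/-- Sign of position `p` for the D46 word: `σ` at the first use of an axis, flipped at the second use inside the window (tool notion).
[cite: MadrasSlade1993, Definition 1.2.4; lane tool notion] -/
def d46sg (k : ℕ) (σ : ℕ → Bool) (p : ℕ) : Bool :=
  if p < k then σ p else if p = k + 3 then !σ (k + 1) else if p = k + 4 then !σ (k + 2) else if p = k + 5 then !σ k
    else if p ≤ k + 2 then σ (d46ax k p) else σ (p - 3)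

/-- `d46ax` stays below the length. [cite: MadrasSlade1993, Definition 1.2.4; lane plumbing] -/
theorem d46ax_lt {l k p : ℕ} (hk : k + 6 ≤ l + 3) (hp : p < l + 3) : d46ax k p < l + 3 := by
  unfold d46ax; split_ifs <;> omega

/-- THE D46 PLACEMENT WORD (length `l + 3`, window at `k`, `k + 6 ≤ l + 3`): a square inside a hexagon (tool notion).
[cite: MadrasSlade1993, Definition 1.2.4; lane tool notion] -/
def d46Word (l k : ℕ) (hk : k + 6 ≤ l + 3) (σ : ℕ → Bool) : Word (l + 3) (l + 3) :=
  fun p => (⟨d46ax k p.val, d46ax_lt hk p.2⟩, d46sg k σ p.val)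

/-- The axis of the D46 word. [cite: MadrasSlade1993, Definition 1.2.4; lane plumbing] -/
theorem d46Word_axis (l k : ℕ) (hk : k + 6 ≤ l + 3) (σ : ℕ → Bool) (p : Fin (l + 3)) :
    ((d46Word l k hk σ p).1 : ℕ) = d46ax k p.val := rfl

/-- Restricted growth of `d46ax`: a positive axis is at most one more than some earlier axis. [cite: MadrasSlade1993, Definition 1.2.4; lane plumbing] -/
theorem d46ax_growth (k p : ℕ) (h : 0 < d46ax k p) : ∃ q : ℕ, q < p ∧ d46ax k p ≤ d46ax k q + 1 := by
  by_cases h6 : p = k + 6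
  · refine ⟨k + 4, by omega, ?_⟩
    subst h6
    simp only [d46ax]
    split_ifs <;> omega
  · have hp0 : 0 < p := by
      by_contra hz
      simp only [d46ax] at h
      split_ifs at h <;> omega
    refine ⟨p - 1, by omega, ?_⟩
    simp only [d46ax]
    split_ifs <;> omega

/-- Restricted growth ⇒ the D46 word is canonical. [cite: MadrasSlade1993, Definition 1.2.4; lane lemma] -/
theorem canon_d46Word (l k : ℕ) (hk : k + 6 ≤ l + 3) (σ : ℕ → Bool) : canon (d46Word l k hk σ) = d46Word l k hk σ := by
  rw [← growthOK_iff_canon_eq]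
  intro p
  rw [d46Word_axis]
  by_cases h0 : d46ax k p.val = 0
  · rw [h0]; exact Nat.zero_le _
  · -- the previous position carries at least `axis − 1`
    have hq : ∃ q : ℕ, q < p.val ∧ d46ax k p.val ≤ d46ax k q + 1 := d46ax_growth k p.val (Nat.pos_of_ne_zero h0)
    obtain ⟨q, hqp, hle⟩ := hq
    refine hle.trans ?_
    have hmem : (⟨q, by omega⟩ : Fin (l + 3)) ∈ Finset.univ.filter (fun q' : Fin (l + 3) => q' < p) :=
      Finset.mem_filter.2 ⟨Finset.mem_univ _, by change q < p.val; exact hqp⟩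
    exact Finset.le_sup (f := fun q' : Fin (l + 3) => ((d46Word l k hk σ q').1 : ℕ) + 1) hmem

/-- No immediate reversal in the D46 word. [cite: MadrasSlade1993, Definition 1.2.4; lane lemma] -/
theorem noRev_d46Word (l k : ℕ) (hk : k + 6 ≤ l + 3) (σ : ℕ → Bool) :
    ∀ p : Fin (l + 3), ∀ hp : p.val + 1 < l + 3,
      d46Word l k hk σ ⟨p.val + 1, hp⟩ ≠ ((d46Word l k hk σ p).1, !(d46Word l k hk σ p).2) := by
  intro p hp h
  have hax : d46ax k (p.val + 1) = d46ax k p.val := by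
    have := congrArg (fun x : Idx (l + 3) => (x.1 : ℕ)) h
    simpa [d46Word] using this
  unfold d46ax at hax
  split_ifs at hax <;> omega

/-- The window letters of the D46 word. [cite: MadrasSlade1993, Definition 1.2.4; lane plumbing] -/
theorem d46_window (k : ℕ) (σ : ℕ → Bool) :
    (d46ax k k = k ∧ d46ax k (k + 1) = k + 1 ∧ d46ax k (k + 2) = k + 2 ∧ d46ax k (k + 3) = k + 1 ∧ d46ax k (k + 4) = k + 2 ∧
      d46ax k (k + 5) = k) ∧
    (d46sg k σ k = σ k ∧ d46sg k σ (k + 1) = σ (k + 1) ∧ d46sg k σ (k + 2) = σ (k + 2) ∧ d46sg k σ (k + 3) = !σ (k + 1) ∧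
      d46sg k σ (k + 4) = !σ (k + 2) ∧ d46sg k σ (k + 5) = !σ k) := by
  have A : d46ax k k = k ∧ d46ax k (k + 1) = k + 1 ∧ d46ax k (k + 2) = k + 2 ∧ d46ax k (k + 3) = k + 1 ∧
      d46ax k (k + 4) = k + 2 ∧ d46ax k (k + 5) = k := by
    unfold d46ax; refine ⟨?_, ?_, ?_, ?_, ?_, ?_⟩ <;> simp
  obtain ⟨a0, a1, a2, a3, a4, a5⟩ := A
  refine ⟨⟨a0, a1, a2, a3, a4, a5⟩, ?_, ?_, ?_, ?_, ?_, ?_⟩ <;> simp [d46sg, a0, a1, a2]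

/-- The square `(k+1, k+5)` and the hexagon `(k, k+6)` of the D46 word. [cite: MadrasSlade1993, Definition 1.2.4; lane lemma] -/
theorem wordPos_d46Word_rep (l k : ℕ) (hk : k + 6 ≤ l + 3) (σ : ℕ → Bool) :
    wordPos (d46Word l k hk σ) (k + 1) = wordPos (d46Word l k hk σ) (k + 5) ∧
      wordPos (d46Word l k hk σ) k = wordPos (d46Word l k hk σ) (k + 6) := by
  set w := d46Word l k hk σ with hw
  have s0 : wordPos w (k + 1) = wordPos w k + stepVec (w ⟨k, by omega⟩) := wordPos_succ w (by omega)
  have s1 : wordPos w (k + 2) = wordPos w (k + 1) + stepVec (w ⟨k + 1, by omega⟩) := wordPos_succ w (by omega)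
  have s2 : wordPos w (k + 3) = wordPos w (k + 2) + stepVec (w ⟨k + 2, by omega⟩) := wordPos_succ w (by omega)
  have s3 : wordPos w (k + 4) = wordPos w (k + 3) + stepVec (w ⟨k + 3, by omega⟩) := wordPos_succ w (by omega)
  have s4 : wordPos w (k + 5) = wordPos w (k + 4) + stepVec (w ⟨k + 4, by omega⟩) := wordPos_succ w (by omega)
  have s5 : wordPos w (k + 6) = wordPos w (k + 5) + stepVec (w ⟨k + 5, by omega⟩) := wordPos_succ w (by omega)
  obtain ⟨⟨a0, a1, a2, a3, a4, a5⟩, g0, g1, g2, g3, g4, g5⟩ := d46_window k σ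
  have e1 : stepVec (w ⟨k + 1, by omega⟩) + stepVec (w ⟨k + 3, by omega⟩) = 0 := by
    rw [stepVec_add_eq_zero_iff_eq_rev, hw]; unfold d46Word; ext <;> simp [a1, a3, g1, g3]
  have e2 : stepVec (w ⟨k + 2, by omega⟩) + stepVec (w ⟨k + 4, by omega⟩) = 0 := by
    rw [stepVec_add_eq_zero_iff_eq_rev, hw]; unfold d46Word; ext <;> simp [a2, a4, g2, g4]
  have e3 : stepVec (w ⟨k, by omega⟩) + stepVec (w ⟨k + 5, by omega⟩) = 0 := by
    rw [stepVec_add_eq_zero_iff_eq_rev, hw]; unfold d46Word; ext <;> simp [a0, a5, g0, g5]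
  have hsq : wordPos w (k + 5) = wordPos w (k + 1) + (stepVec (w ⟨k + 1, by omega⟩) + stepVec (w ⟨k + 3, by omega⟩)) +
      (stepVec (w ⟨k + 2, by omega⟩) + stepVec (w ⟨k + 4, by omega⟩)) := by
    rw [s4, s3, s2, s1]; abel
  have hhex : wordPos w (k + 6) = wordPos w k + (stepVec (w ⟨k, by omega⟩) + stepVec (w ⟨k + 5, by omega⟩)) +
      (stepVec (w ⟨k + 1, by omega⟩) + stepVec (w ⟨k + 3, by omega⟩)) + (stepVec (w ⟨k + 2, by omega⟩) + stepVec (w ⟨k + 4, by omega⟩)) := by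
    rw [s5, s4, s3, s2, s1, s0]; abel
  refine ⟨?_, ?_⟩
  · rw [hsq, e1, e2, add_zero, add_zero]
  · rw [hhex, e1, e2, e3, add_zero, add_zero, add_zero]

/-- `d46ax` stays below `l`. [cite: MadrasSlade1993, Definition 1.2.4; lane plumbing] -/
theorem d46ax_lt_l {l k p : ℕ} (hk : k + 6 ≤ l + 3) (hp : p < l + 3) : d46ax k p < l := by
  unfold d46ax; split_ifs <;> omega

/-- The D46 word uses exactly the axes `0, …, l−1`. [cite: MadrasSlade1993, Definition 1.2.4; lane lemma] -/
theorem numAxes_d46Word (l k : ℕ) (hk : k + 6 ≤ l + 3) (σ : ℕ → Bool) : numAxes (d46Word l k hk σ) = l := by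
  classical
  rw [numAxes_eq_card_image]
  have himg : (Finset.univ.image fun p : Fin (l + 3) => (d46Word l k hk σ p).1) =
      (Finset.univ : Finset (Fin l)).map (Fin.castLEEmb (by omega : l ≤ l + 3)) := by
    ext a
    simp only [Finset.mem_image, Finset.mem_univ, true_and, Finset.mem_map, Fin.castLEEmb_apply]
    constructor
    · rintro ⟨p, hp⟩
      have ha : a.val < l := by rw [← hp]; exact d46ax_lt_l hk p.2
      exact ⟨⟨a.val, ha⟩, Fin.ext rfl⟩
    · rintro ⟨b, rfl⟩
      by_cases h2 : b.val ≤ k + 2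
      · refine ⟨⟨b.val, by omega⟩, Fin.ext ?_⟩
        have : d46ax k b.val = b.val := by unfold d46ax; split_ifs <;> omega
        simpa [d46Word] using this
      · refine ⟨⟨b.val + 3, by omega⟩, Fin.ext ?_⟩
        have : d46ax k (b.val + 3) = b.val := by unfold d46ax; split_ifs <;> omega
        simpa [d46Word] using this
  rw [himg, Finset.card_map, Finset.card_univ, Fintype.card_fin]

/-- The positions whose axis is below the position are exactly `p ≥ k + 3`. [cite: MadrasSlade1993, Definition 1.2.4; lane plumbing] -/
theorem d46ax_lt_self_iff {k p : ℕ} : d46ax k p < p ↔ k + 3 ≤ p := by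
  unfold d46ax; split_ifs <;> omega

/-- Injectivity of the D46 placement. [cite: MadrasSlade1993, Definition 1.2.4; lane lemma] -/
theorem d46Word_inj {l k k' : ℕ} (hk : k + 6 ≤ l + 3) (hk' : k' + 6 ≤ l + 3) {σ σ' : ℕ → Bool}
    (h : d46Word l k hk σ = d46Word l k' hk' σ') : k = k' ∧ ∀ a, a < l → σ a = σ' a := by
  have hax : ∀ p : ℕ, p < l + 3 → d46ax k p = d46ax k' p := fun p hp => by
    have := congrArg (fun w : Word (l + 3) (l + 3) => ((w ⟨p, hp⟩).1 : ℕ)) h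
    simpa [d46Word] using this
  have hkk : k = k' := by
    have h1 := (d46ax_lt_self_iff (k := k) (p := k + 3)).2 le_rfl
    have h2 := (d46ax_lt_self_iff (k := k') (p := k' + 3)).2 le_rfl
    rw [hax (k + 3) (by omega)] at h1
    rw [← hax (k' + 3) (by omega)] at h2
    have := (d46ax_lt_self_iff (k := k')).1 h1
    have := (d46ax_lt_self_iff (k := k)).1 h2
    omega
  subst hkk
  refine ⟨rfl, fun a ha => ?_⟩
  have hsg : ∀ p : ℕ, p < l + 3 → d46sg k σ p = d46sg k σ' p := fun p hp => by
    have := congrArg (fun w : Word (l + 3) (l + 3) => (w ⟨p, hp⟩).2) h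
    simpa [d46Word] using this
  by_cases h1 : a < k
  · have e := hsg a (by omega); unfold d46sg at e; rwa [if_pos h1, if_pos h1] at e
  · by_cases h2 : a ≤ k + 2
    · have e := hsg a (by omega)
      have hx : d46ax k a = a := by unfold d46ax; split_ifs <;> omega
      unfold d46sg at e
      have hB : a ≠ k + 3 := by omega
      have hC : a ≠ k + 4 := by omega
      have hD : a ≠ k + 5 := by omega
      simpa [h1, hB, hC, hD, h2, hx] using e
    · have e := hsg (a + 3) (by omega)
      unfold d46sg at e
      have hA : ¬ a + 3 < k := by omega
      have hB : a + 3 ≠ k + 3 := by omega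
      have hC : a + 3 ≠ k + 4 := by omega
      have hD : a + 3 ≠ k + 5 := by omega
      have hE : ¬ a + 3 ≤ k + 2 := by omega
      have hF : a ≠ k := by omega
      have hG : a ≠ k + 1 := by omega
      have hH : a ≠ k + 2 := by omega
      simpa [hA, hB, hC, hD, hE, hF, hG, hH] using e

/-- The D46 placement as a total function (tool notion). [cite: MadrasSlade1993, Definition 1.2.4; lane tool notion] -/
def d46WordT (l : ℕ) (x : ℕ × (Fin l → Bool)) : Word (l + 3) (l + 3) :=
  if h : x.1 + 6 ≤ l + 3 then d46Word l x.1 h (fun a => if ha : a < l then x.2 ⟨a, ha⟩ else false) else fun _ => (0, false)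

open Classical in
/-- ★★ THE CLASS-D46 LOWER BOUND of the census law (L1): at least `(n−5)·2^{n−3}` canonical reversal-free words of length `n = l + 3` with
`l` axes have a square inside a hexagon (repeats at `(k+1,k+5)` and `(k,k+6)`); the lane's enumeration says exactly that many (class `(4,6)`).
[cite: MadrasSlade1993, Definition 1.2.4; §1.1 eq. (1.1.8) p. 5; lane theorem] -/
theorem mul_pow_le_card_squareInHexagon_canonical (l : ℕ) :
    (l - 2) * 2 ^ l ≤ (Finset.univ.filter fun τ : Word (l + 3) (l + 3) => canon τ = τ ∧ numAxes τ = l ∧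
        (∀ p : Fin (l + 3), ∀ hp : p.val + 1 < l + 3, τ ⟨p.val + 1, hp⟩ ≠ ((τ p).1, !(τ p).2)) ∧
        ∃ k : ℕ, k + 6 ≤ l + 3 ∧ wordPos τ (k + 1) = wordPos τ (k + 5) ∧ wordPos τ k = wordPos τ (k + 6)).card := by
  set P : Finset (ℕ × (Fin l → Bool)) := (Finset.range (l - 2)) ×ˢ Finset.univ with hP
  have hPcard : P.card = (l - 2) * 2 ^ l := by
    rw [hP, Finset.card_product, Finset.card_range, Finset.card_univ, Fintype.card_fun, Fintype.card_bool, Fintype.card_fin]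
  rw [← hPcard]
  refine Finset.card_le_card_of_injOn (d46WordT l) (fun x hx => ?_) (fun x hx y hy hxy => ?_)
  · obtain ⟨hk, -⟩ := Finset.mem_product.1 hx
    have hk6 : x.1 + 6 ≤ l + 3 := by have := Finset.mem_range.1 hk; omega
    simp only [Finset.coe_filter, Finset.mem_univ, true_and, Set.mem_setOf_eq, d46WordT, dif_pos hk6]
    exact ⟨canon_d46Word l x.1 hk6 _, numAxes_d46Word l x.1 hk6 _, noRev_d46Word l x.1 hk6 _, x.1, hk6,
      (wordPos_d46Word_rep l x.1 hk6 _).1, (wordPos_d46Word_rep l x.1 hk6 _).2⟩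
  · obtain ⟨hkx, -⟩ := Finset.mem_product.1 hx
    obtain ⟨hky, -⟩ := Finset.mem_product.1 hy
    have hx6 : x.1 + 6 ≤ l + 3 := by have := Finset.mem_range.1 hkx; omega
    have hy6 : y.1 + 6 ≤ l + 3 := by have := Finset.mem_range.1 hky; omega
    simp only [d46WordT, dif_pos hx6, dif_pos hy6] at hxy
    obtain ⟨hk, hσ⟩ := d46Word_inj hx6 hy6 hxy
    refine Prod.ext hk (funext fun a => ?_)
    have := hσ a.val a.2
    simpa using this


end WordTypes

end Literature.Probability.RandomPlanarGeometry.SAW.Zd
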